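/-
Summits/MatrixMultiplication/MatrixMultiplication/Theorems/TetraResidualNecessitySharp.lean
decomp-mm lens 6 («barrier-complement carving»), generation 28 — supports item 27058 (TetraPlusTwo,
the declared residual of route TetrahedronCarving).  Part 4a: sharpness of the model no-go.
-/
import Summits.MatrixMultiplication.MatrixMultiplication.Theorems.TetraResidualNecessityInstances

/-!
# Residual necessity, part 4a: S-world rigidity, hull laws, room

Parts 1–3 prove, in BODY SEMANTICS on the tetrahedron carrier (worlds `Δ₀ ⊆ Δ ⊆ K` of exponent
vectors of the six EPR legs of `K₄`, coordinates `01,02,12,03,13,23`; exponent of a weighted object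
`u` = support value `sval Δ u`), that every FINITE family of support-linear pieces TRUE AT `Δ₀`
forcing `ω ≤ 2` (`Cap k4tri 2`) in a lawful region with ROOM along `x₀ + ε·tri` contains an
ω-bounding piece tight at `ω = 2` (`k4_residual_necessity`).  Parts 4a/4b make this sharp.
* §5 sublinearity of `u ↦ sval Δ u`; `sval (convexHull Δ) = sval Δ`; **room**
  (`forces_of_capped_region`): if the lawful region itself caps the triangle, every family forces —
  the room hypothesis excludes exactly the regions that are ω-bounding laws in their own right.
* §6 **hull-internal laws are useless** (`forces_cons_hullLaw_iff`, `forces_cons_convex_iff`,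
  `forces_cons_starConvex_iff`): adjoining «the body is convex» / «star-convex along the mandatory
  points» to any family of support-linear pieces does not change what it forces.
* §7 **S-world rigidity** (`sval_eq_flat7`): in every world between the seven flattening points and
  the `ω = 2` box `k4box 2` (`[0,1]⁶`, all four triangle sums `≤ 2`) the support value of EVERY
  nonnegative direction is its flattening value `flat7 u` — an LP-integrality fact (`flat_dominates`;
  the vertices of that polytope are the `0/1` triangle-free edge sets of `K₄`).  Hence (`sNec_iff`)
  a support-linear piece with nonnegative directions holds in EVERY `ω = 2` world iff it holds at the
  FLAT WORLD `k4flatSet`: the necessity reading «true at `Δ₀`» of parts 1–3 is forced, not a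
  convention (door D1 of memo NODE-g27 closed).  Reading: if `ω = 2` then every nonnegatively
  weighted `K₄` object is flat (`ω(K₄) = ψ = ω(2,1,2) = 4`, …).
Pure convex geometry over `Mathlib`; no tensor input, no `sorry`, no new axiom, no instance, no notation.
-/

open Filter Topology Set

namespace Summit.MatrixMultiplication.MatrixMultiplication.Theorems.TetraResidualNecessity

/-! ### 5. Sublinearity of support values; hulls; room -/

section Sublinear

variable {ι : Type*} [Fintype ι]

/-- additivity of the pairing in the point -/
theorem dot_add_right (u x y : ι → ℝ) : dot u (x + y) = dot u x + dot u y := by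
  simp only [dot, Pi.add_apply, mul_add, Finset.sum_add_distrib]

/-- homogeneity of the pairing in the point -/
theorem dot_smul_right (u : ι → ℝ) (c : ℝ) (x : ι → ℝ) : dot u (c • x) = c * dot u x := by
  simp only [dot, Pi.smul_apply, smul_eq_mul, Finset.mul_sum]
  exact Finset.sum_congr rfl (fun i _ => by ring)

/-- additivity of the pairing in the direction -/
theorem dot_add_left (u v β : ι → ℝ) : dot (u + v) β = dot u β + dot v β := by
  simp only [dot, Pi.add_apply, add_mul, Finset.sum_add_distrib]

/-- the pairing with a fixed direction is a linear map -/
theorem isLinearMap_dot (u : ι → ℝ) : IsLinearMap ℝ (fun β : ι → ℝ => dot u β) :=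
  IsLinearMap.mk (fun x y => dot_add_right u x y) (fun c x => dot_smul_right u c x)

/-- `sval` is subadditive in the direction, in every tame world -/
theorem sval_add_le {Δ : Set (ι → ℝ)} (hΔ : Tame Δ) (u v : ι → ℝ) :
    sval Δ (u + v) ≤ sval Δ u + sval Δ v :=
  sval_le hΔ _ (fun β hβ => by
    rw [dot_add_left]; exact add_le_add (le_sval hΔ u hβ) (le_sval hΔ v hβ))

/-- `sval` is positively (sub)homogeneous in the direction -/
theorem sval_smul_le {Δ : Set (ι → ℝ)} (hΔ : Tame Δ) {μ : ℝ} (hμ : 0 ≤ μ) (u : ι → ℝ) :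
    sval Δ (μ • u) ≤ μ * sval Δ u :=
  sval_le hΔ _ (fun β hβ => by
    rw [dot_smul_left]; exact mul_le_mul_of_nonneg_left (le_sval hΔ u hβ) hμ)

/-- a world between a nonempty set and a bounded region is tame -/
theorem tame_of_between {Δ₀ Δ K : Set (ι → ℝ)} (hne : Δ₀.Nonempty)
    (hKb : ∀ u, BddAbove (dot u '' K)) (h₀ : Δ₀ ⊆ Δ) (hK : Δ ⊆ K) : Tame Δ :=
  ⟨hne.mono h₀, fun u => (hKb u).mono (image_mono hK)⟩

/-- support values do not see convex combinations: `sval (convexHull Δ) = sval Δ` -/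
theorem sval_convexHull {Δ : Set (ι → ℝ)} (hΔ : Tame Δ) (u : ι → ℝ) :
    sval (convexHull ℝ Δ) u = sval Δ u := by
  have hsub : convexHull ℝ Δ ⊆ {β | dot u β ≤ sval Δ u} :=
    convexHull_min (fun β hβ => le_sval hΔ u hβ) (convex_halfSpace_le (isLinearMap_dot u) _)
  have hbdd : BddAbove (dot u '' convexHull ℝ Δ) :=
    ⟨sval Δ u, by rintro _ ⟨β, hβ, rfl⟩; exact hsub hβ⟩
  apply le_antisymm
  · exact csSup_le ((hΔ.nonempty.mono (subset_convexHull ℝ Δ)).image _)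
      (by rintro _ ⟨β, hβ, rfl⟩; exact hsub hβ)
  · exact csSup_le_csSup hbdd (hΔ.nonempty.image _) (image_mono (subset_convexHull ℝ Δ))

/-- **Room.**  If the lawful region itself caps the direction `t` at `s`, every family (even the
empty one) «forces» `Cap t s`: the room hypothesis of residual necessity excludes exactly the
regions `K` that are ω-bounding laws in their own right. -/
theorem forces_of_capped_region {Δ₀ K : Set (ι → ℝ)} (hne : Δ₀.Nonempty) {t : ι → ℝ} {s : ℝ}
    (hK : ∀ β ∈ K, dot t β ≤ s) (Ps : List (Set (ι → ℝ) → Prop)) : Forces Δ₀ K Ps (Cap t s) := by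
  intro Δ h₀ hΔK _
  exact csSup_le ((hne.mono h₀).image _) (by rintro _ ⟨β, hβ, rfl⟩; exact hK β (hΔK hβ))

end Sublinear

/-! ### 6. Hull-internal closure laws never help -/

section Hull

variable {ι : Type*} [Fintype ι]

/-- **A law satisfiable by passing to the convex hull adds no forcing power.**  If `L` holds on the
convex hull of every world (convexity of the body, star-convexity along flattening points, …) and
`K` is convex and bounded, then `L :: Ps` forces a cap iff `Ps` does, for every family `Ps` of
support-linear pieces: support values do not see the hull (`sval_convexHull`). -/
theorem forces_cons_hullLaw_iff {Δ₀ K : Set (ι → ℝ)} (hne : Δ₀.Nonempty)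
    (hKb : ∀ u, BddAbove (dot u '' K)) (hKc : Convex ℝ K) (L : Set (ι → ℝ) → Prop)
    (hL : ∀ Δ : Set (ι → ℝ), Δ₀ ⊆ Δ → Δ ⊆ K → L (convexHull ℝ Δ)) (Ps : List (LinData ι))
    (t : ι → ℝ) (s : ℝ) :
    Forces Δ₀ K (L :: Ps.map LinData.holds) (Cap t s) ↔
      Forces Δ₀ K (Ps.map LinData.holds) (Cap t s) := by
  constructor
  · intro hF Δ h₀ hK hP
    have hΔ : Tame Δ := tame_of_between hne hKb h₀ hK
    have hsv : ∀ u, sval (convexHull ℝ Δ) u = sval Δ u := sval_convexHull hΔ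
    have hcap := hF (convexHull ℝ Δ) (h₀.trans (subset_convexHull ℝ Δ))
      (convexHull_min hK hKc) (by
        intro P hP'
        rcases List.mem_cons.mp hP' with rfl | hP'
        · exact hL Δ h₀ hK
        · obtain ⟨D, hD, rfl⟩ := List.mem_map.mp hP'
          have hDΔ := hP D.holds (List.mem_map.mpr ⟨D, hD, rfl⟩)
          unfold LinData.holds at hDΔ ⊢
          simpa only [hsv] using hDΔ)
    have hcap' : sval (convexHull ℝ Δ) t ≤ s := hcap
    show sval Δ t ≤ s
    rwa [hsv] at hcap'
  · intro hF Δ h₀ hK hP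
    exact hF Δ h₀ hK (fun P hP' => hP P (List.mem_cons_of_mem _ hP'))

/-- convexity of the body is a useless law -/
theorem forces_cons_convex_iff {Δ₀ K : Set (ι → ℝ)} (hne : Δ₀.Nonempty)
    (hKb : ∀ u, BddAbove (dot u '' K)) (hKc : Convex ℝ K) (Ps : List (LinData ι)) (t : ι → ℝ)
    (s : ℝ) :
    Forces Δ₀ K ((fun Δ => Convex ℝ Δ) :: Ps.map LinData.holds) (Cap t s) ↔
      Forces Δ₀ K (Ps.map LinData.holds) (Cap t s) :=
  forces_cons_hullLaw_iff hne hKb hKc _ (fun Δ _ _ => convex_convexHull ℝ Δ) Ps t s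

/-- star-convexity of the body along the mandatory (flattening) points is a useless law -/
theorem forces_cons_starConvex_iff {Δ₀ K : Set (ι → ℝ)} (hne : Δ₀.Nonempty)
    (hKb : ∀ u, BddAbove (dot u '' K)) (hKc : Convex ℝ K) (Ps : List (LinData ι)) (t : ι → ℝ)
    (s : ℝ) :
    Forces Δ₀ K ((fun Δ => ∀ q ∈ Δ₀, StarConvex ℝ q Δ) :: Ps.map LinData.holds) (Cap t s) ↔
      Forces Δ₀ K (Ps.map LinData.holds) (Cap t s) :=
  forces_cons_hullLaw_iff hne hKb hKc _
    (fun Δ h₀ _ _ hq => (convex_convexHull ℝ Δ).starConvex (subset_convexHull ℝ Δ (h₀ hq))) Ps t s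

end Hull

/-! ### 7. S-world rigidity: under `ω = 2` the `K₄` body is spanned by the flattening points -/

section Rigidity

/-- three numbers in `[0,1]` with sum `≤ 2` are covered by a sub-probability vector on the three
perfect matchings of `K₄` (`a ≤ μ₂ + μ₃`, `b ≤ μ₁ + μ₃`, `c ≤ μ₁ + μ₂`) -/
theorem cover3 {a b c : ℝ} (ha0 : 0 ≤ a) (hb0 : 0 ≤ b) (hc0 : 0 ≤ c) (ha1 : a ≤ 1) (hb1 : b ≤ 1)
    (hc1 : c ≤ 1) (h : a + b + c ≤ 2) :
    ∃ μ₁ μ₂ μ₃ : ℝ, 0 ≤ μ₁ ∧ 0 ≤ μ₂ ∧ 0 ≤ μ₃ ∧ μ₁ + μ₂ + μ₃ ≤ 1 ∧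
      a ≤ μ₂ + μ₃ ∧ b ≤ μ₁ + μ₃ ∧ c ≤ μ₁ + μ₂ := by
  rcases le_or_gt (b + c) a with h1 | h1
  · exact ⟨0, a - b, b, le_rfl, by linarith, hb0, by linarith, by linarith, by linarith,
      by linarith⟩
  rcases le_or_gt (a + c) b with h2 | h2
  · exact ⟨b - a, 0, a, by linarith, le_rfl, ha0, by linarith, by linarith, by linarith,
      by linarith⟩
  rcases le_or_gt (a + b) c with h3 | h3
  · exact ⟨c - a, a, 0, by linarith, ha0, le_rfl, by linarith, by linarith, by linarith,
      by linarith⟩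
  · exact ⟨(b + c - a) / 2, (a + c - b) / 2, (a + b - c) / 2, by linarith, by linarith,
      by linarith, by linarith, by linarith, by linarith, by linarith⟩

/-- cover leaf: the big coordinates `x ≥ x'`, `y ≥ y'`, `z ≥ z'` of the three matchings have total
`≤ 2`; then `⟨u,β⟩` is dominated through the three `2|2` flattening points -/
theorem leaf_cover {x x' y y' z z' ux ux' uy uy' uz uz' M : ℝ}
    (hux : 0 ≤ ux) (hux' : 0 ≤ ux') (huy : 0 ≤ uy) (huy' : 0 ≤ uy') (huz : 0 ≤ uz)
    (huz' : 0 ≤ uz') (hx0 : 0 ≤ x) (hy0 : 0 ≤ y) (hz0 : 0 ≤ z) (hx1 : x ≤ 1) (hy1 : y ≤ 1)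
    (hz1 : z ≤ 1) (hx' : x' ≤ x) (hy' : y' ≤ y) (hz' : z' ≤ z) (hA : x + y + z ≤ 2)
    (hf1 : uy + uy' + uz + uz' ≤ M) (hf2 : ux + ux' + uz + uz' ≤ M)
    (hf3 : ux + ux' + uy + uy' ≤ M) :
    ux * x + ux' * x' + uy * y + uy' * y' + uz * z + uz' * z' ≤ M := by
  obtain ⟨μ₁, μ₂, μ₃, h1, h2, h3, hs, ha, hb, hc⟩ := cover3 hx0 hy0 hz0 hx1 hy1 hz1 hA
  have hM : 0 ≤ M := by linarith
  have e1 : ux * x ≤ ux * (μ₂ + μ₃) := mul_le_mul_of_nonneg_left ha hux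
  have e2 : ux' * x' ≤ ux' * (μ₂ + μ₃) := mul_le_mul_of_nonneg_left (hx'.trans ha) hux'
  have e3 : uy * y ≤ uy * (μ₁ + μ₃) := mul_le_mul_of_nonneg_left hb huy
  have e4 : uy' * y' ≤ uy' * (μ₁ + μ₃) := mul_le_mul_of_nonneg_left (hy'.trans hb) huy'
  have e5 : uz * z ≤ uz * (μ₁ + μ₂) := mul_le_mul_of_nonneg_left hc huz
  have e6 : uz' * z' ≤ uz' * (μ₁ + μ₂) := mul_le_mul_of_nonneg_left (hz'.trans hc) huz'
  have g1 : μ₁ * (uy + uy' + uz + uz') ≤ μ₁ * M := mul_le_mul_of_nonneg_left hf1 h1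
  have g2 : μ₂ * (ux + ux' + uz + uz') ≤ μ₂ * M := mul_le_mul_of_nonneg_left hf2 h2
  have g3 : μ₃ * (ux + ux' + uy + uy') ≤ μ₃ * M := mul_le_mul_of_nonneg_left hf3 h3
  have g4 : (μ₁ + μ₂ + μ₃) * M ≤ 1 * M := mul_le_mul_of_nonneg_right hs hM
  linarith

/-- star leaf: the big coordinates form a star with total `> 2`; then `⟨u,β⟩` is dominated through
the star point (weight `x+y+z-2`) and the three `2|2` points (weights `1-x, 1-y, 1-z`), the partner
coordinates being controlled by the three triangles through the centre of the star -/
theorem leaf_star {x x' y y' z z' ux ux' uy uy' uz uz' M : ℝ}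
    (hux' : 0 ≤ ux') (huy' : 0 ≤ uy') (huz' : 0 ≤ uz') (hx1 : x ≤ 1) (hy1 : y ≤ 1) (hz1 : z ≤ 1)
    (hA : 2 < x + y + z) (htx : x' + y + z ≤ 2) (hty : x + y' + z ≤ 2) (htz : x + y + z' ≤ 2)
    (hs : ux + uy + uz ≤ M) (hf1 : uy + uy' + uz + uz' ≤ M) (hf2 : ux + ux' + uz + uz' ≤ M)
    (hf3 : ux + ux' + uy + uy' ≤ M) :
    ux * x + ux' * x' + uy * y + uy' * y' + uz * z + uz' * z' ≤ M := by
  have hl : 0 ≤ x + y + z - 2 := by linarith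
  have e2 : ux' * x' ≤ ux' * (2 - y - z) := mul_le_mul_of_nonneg_left (by linarith) hux'
  have e4 : uy' * y' ≤ uy' * (2 - x - z) := mul_le_mul_of_nonneg_left (by linarith) huy'
  have e6 : uz' * z' ≤ uz' * (2 - x - y) := mul_le_mul_of_nonneg_left (by linarith) huz'
  have g0 : (x + y + z - 2) * (ux + uy + uz) ≤ (x + y + z - 2) * M :=
    mul_le_mul_of_nonneg_left hs hl
  have g1 : (1 - x) * (uy + uy' + uz + uz') ≤ (1 - x) * M :=
    mul_le_mul_of_nonneg_left hf1 (by linarith)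
  have g2 : (1 - y) * (ux + ux' + uz + uz') ≤ (1 - y) * M :=
    mul_le_mul_of_nonneg_left hf2 (by linarith)
  have g3 : (1 - z) * (ux + ux' + uy + uy') ≤ (1 - z) * M :=
    mul_le_mul_of_nonneg_left hf3 (by linarith)
  linarith

/-- **Domination lemma.**  A point of the unit box whose four triangle sums are `≤ 2` is dominated,
in every nonnegative direction `u`, by the seven flattening points: `⟨u,β⟩ ≤ M` as soon as
`⟨u,q⟩ ≤ M` for the four stars and the three `2|2` points.  (LP-integrality of the triangle-capped
box of `K₄`: its vertices are the `0/1` triangle-free edge sets, all inside a star or a 4-cycle.) -/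
theorem flat_dominates (u β : Fin 6 → ℝ) (hu : ∀ i, 0 ≤ u i) (hβ : ∀ i, 0 ≤ β i ∧ β i ≤ 1)
    (ht : dot k4tri β ≤ 2) (ht0 : dot k4tri0 β ≤ 2) (ht1 : dot k4tri1 β ≤ 2)
    (ht2 : dot k4tri2 β ≤ 2) {M : ℝ} (h0 : dot u k4s0 ≤ M) (h1 : dot u k4s1 ≤ M)
    (h2 : dot u k4s2 ≤ M) (h3 : dot u k4s3 ≤ M) (h4 : dot u k4f1 ≤ M) (h5 : dot u k4f2 ≤ M)
    (h6 : dot u k4f3 ≤ M) : dot u β ≤ M := by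
  have b0 := hβ 0; have b1 := hβ 1; have b2 := hβ 2; have b3 := hβ 3; have b4 := hβ 4
  have b5 := hβ 5
  have u0 := hu 0; have u1 := hu 1; have u2 := hu 2; have u3 := hu 3; have u4 := hu 4
  have u5 := hu 5
  simp only [dot6, k4tri, k4tri0, k4tri1, k4tri2, k4s0, k4s1, k4s2, k4s3, k4f1, k4f2, k4f3]
    at ht ht0 ht1 ht2 h0 h1 h2 h3 h4 h5 h6 ⊢
  simp at ht ht0 ht1 ht2 h0 h1 h2 h3 h4 h5 h6
  -- big coordinate of each matching `01|23 = (0,5)`, `02|13 = (1,4)`, `12|03 = (2,3)`; the big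
  -- edges form, in order: triangle 012, star 0, star 1, triangle 013, star 2, triangle 023,
  -- triangle 123, star 3 (a star case splits further on its total `≤ 2` / `> 2`)
  rcases le_total (β 5) (β 0) with c1 | c1 <;> rcases le_total (β 4) (β 1) with c2 | c2 <;>
    rcases le_total (β 3) (β 2) with c3 | c3
  · linarith [leaf_cover (M := M) u0 u5 u1 u4 u2 u3 b0.1 b1.1 b2.1 b0.2 b1.2 b2.2 c1 c2 c3
      (by linarith) (by linarith) (by linarith) (by linarith)]
  · rcases le_or_gt (β 0 + β 1 + β 3) 2 with hA | hA
    · linarith [leaf_cover (M := M) u0 u5 u1 u4 u3 u2 b0.1 b1.1 b3.1 b0.2 b1.2 b3.2 c1 c2 c3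
        hA (by linarith) (by linarith) (by linarith)]
    · linarith [leaf_star (M := M) (ux := u 0) (uy := u 1) (uz := u 3) (x' := β 5) (y' := β 4)
        (z' := β 2) u5 u4 u2 b0.2 b1.2 b3.2 hA (by linarith) (by linarith) (by linarith)
        (by linarith) (by linarith) (by linarith) (by linarith)]
  · rcases le_or_gt (β 0 + β 4 + β 2) 2 with hA | hA
    · linarith [leaf_cover (M := M) u0 u5 u4 u1 u2 u3 b0.1 b4.1 b2.1 b0.2 b4.2 b2.2 c1 c2 c3
        hA (by linarith) (by linarith) (by linarith)]
    · linarith [leaf_star (M := M) (ux := u 0) (uy := u 4) (uz := u 2) (x' := β 5) (y' := β 1)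
        (z' := β 3) u5 u1 u3 b0.2 b4.2 b2.2 hA (by linarith) (by linarith) (by linarith)
        (by linarith) (by linarith) (by linarith) (by linarith)]
  · linarith [leaf_cover (M := M) u0 u5 u4 u1 u3 u2 b0.1 b4.1 b3.1 b0.2 b4.2 b3.2 c1 c2 c3
      (by linarith) (by linarith) (by linarith) (by linarith)]
  · rcases le_or_gt (β 5 + β 1 + β 2) 2 with hA | hA
    · linarith [leaf_cover (M := M) u5 u0 u1 u4 u2 u3 b5.1 b1.1 b2.1 b5.2 b1.2 b2.2 c1 c2 c3
        hA (by linarith) (by linarith) (by linarith)]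
    · linarith [leaf_star (M := M) (ux := u 5) (uy := u 1) (uz := u 2) (x' := β 0) (y' := β 4)
        (z' := β 3) u0 u4 u3 b5.2 b1.2 b2.2 hA (by linarith) (by linarith) (by linarith)
        (by linarith) (by linarith) (by linarith) (by linarith)]
  · linarith [leaf_cover (M := M) u5 u0 u1 u4 u3 u2 b5.1 b1.1 b3.1 b5.2 b1.2 b3.2 c1 c2 c3
      (by linarith) (by linarith) (by linarith) (by linarith)]
  · linarith [leaf_cover (M := M) u5 u0 u4 u1 u2 u3 b5.1 b4.1 b2.1 b5.2 b4.2 b2.2 c1 c2 c3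
      (by linarith) (by linarith) (by linarith) (by linarith)]
  · rcases le_or_gt (β 5 + β 4 + β 3) 2 with hA | hA
    · linarith [leaf_cover (M := M) u5 u0 u4 u1 u3 u2 b5.1 b4.1 b3.1 b5.2 b4.2 b3.2 c1 c2 c3
        hA (by linarith) (by linarith) (by linarith)]
    · linarith [leaf_star (M := M) (ux := u 5) (uy := u 4) (uz := u 3) (x' := β 0) (y' := β 1)
        (z' := β 2) u0 u1 u2 b5.2 b4.2 b3.2 hA (by linarith) (by linarith) (by linarith)
        (by linarith) (by linarith) (by linarith) (by linarith)]

/-- the flattening support function: the largest pairing with the seven flattening points -/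
noncomputable def flat7 (u : Fin 6 → ℝ) : ℝ :=
  max (dot u k4s0) (max (dot u k4s1) (max (dot u k4s2) (max (dot u k4s3)
    (max (dot u k4f1) (max (dot u k4f2) (dot u k4f3))))))

/-- each flattening point is below the flattening value -/
theorem dot_le_flat7 (u : Fin 6 → ℝ) : ∀ q ∈ k4flat, dot u q ≤ flat7 u := by
  intro q hq
  simp only [k4flat, List.mem_cons, List.mem_nil_iff, or_false] at hq
  rcases hq with rfl | rfl | rfl | rfl | rfl | rfl | rfl <;>
    simp only [flat7, le_max_iff, le_refl, true_or, or_true]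

/-- a common bound on the seven flattening points bounds the flattening value -/
theorem flat7_le {u : Fin 6 → ℝ} {M : ℝ} (h : ∀ q ∈ k4flat, dot u q ≤ M) : flat7 u ≤ M := by
  simp only [flat7, max_le_iff]
  exact ⟨h _ (by simp [k4flat]), h _ (by simp [k4flat]), h _ (by simp [k4flat]),
    h _ (by simp [k4flat]), h _ (by simp [k4flat]), h _ (by simp [k4flat]), h _ (by simp [k4flat])⟩

/-- every direction is bounded on a record box -/
theorem k4box_bddAbove (ωbar : ℝ) (u : Fin 6 → ℝ) : BddAbove (dot u '' k4box ωbar) := by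
  refine ⟨∑ i, |u i|, ?_⟩
  rintro _ ⟨β, hβ, rfl⟩
  unfold dot
  apply Finset.sum_le_sum
  intro i _
  have hb0 := (hβ.1 i).1; have hb1 := (hβ.1 i).2
  calc u i * β i ≤ |u i| * β i := mul_le_mul_of_nonneg_right (le_abs_self _) hb0
    _ ≤ |u i| * 1 := mul_le_mul_of_nonneg_left hb1 (abs_nonneg _)
    _ = |u i| := mul_one _

/-- a nonempty world inside a record box is tame -/
theorem tame_of_subset_k4box {Δ : Set (Fin 6 → ℝ)} {ωbar : ℝ} (hne : Δ.Nonempty)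
    (hK : Δ ⊆ k4box ωbar) : Tame Δ :=
  ⟨hne, fun u => (k4box_bddAbove ωbar u).mono (image_mono hK)⟩

/-- a convex combination of two numbers below `c` is below `c` -/
theorem convexComb_le {a b p q c : ℝ} (ha : 0 ≤ a) (hb : 0 ≤ b) (hab : a + b = 1) (hp : p ≤ c)
    (hq : q ≤ c) : a * p + b * q ≤ c := by
  have h1 : a * p ≤ a * c := mul_le_mul_of_nonneg_left hp ha
  have h2 : b * q ≤ b * c := mul_le_mul_of_nonneg_left hq hb
  have h3 : a * c + b * c = c := by rw [← add_mul, hab, one_mul]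
  linarith

/-- record boxes are convex -/
theorem k4box_convex (ωbar : ℝ) : Convex ℝ (k4box ωbar) := by
  intro x hx y hy a b ha hb hab
  simp only [k4box, mem_setOf_eq] at hx hy ⊢
  obtain ⟨hxb, hx1, hx2, hx3, hx4⟩ := hx
  obtain ⟨hyb, hy1, hy2, hy3, hy4⟩ := hy
  refine ⟨fun i => ?_, ?_, ?_, ?_, ?_⟩
  · have hxi := hxb i; have hyi := hyb i
    simp only [Pi.add_apply, Pi.smul_apply, smul_eq_mul]
    constructor <;> nlinarith
  all_goals
    rw [dot_add_right, dot_smul_right, dot_smul_right]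
  · exact convexComb_le ha hb hab hx1 hy1
  · exact convexComb_le ha hb hab hx2 hy2
  · exact convexComb_le ha hb hab hx3 hy3
  · exact convexComb_le ha hb hab hx4 hy4

/-- a world in a record box satisfying the cap for all four (equivalent) triangles lies in the
`ω = 2` box: the S-worlds of the model are exactly the worlds between `Δ₀` and `k4box 2` -/
theorem subset_k4box_two_of_caps {Δ : Set (Fin 6 → ℝ)} {ωbar : ℝ} (hΔ : Tame Δ)
    (hK : Δ ⊆ k4box ωbar) (h : Cap k4tri 2 Δ) (h0 : Cap k4tri0 2 Δ) (h1 : Cap k4tri1 2 Δ)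
    (h2 : Cap k4tri2 2 Δ) : Δ ⊆ k4box 2 := fun _ hβ =>
  ⟨(hK hβ).1, (le_sval hΔ _ hβ).trans h, (le_sval hΔ _ hβ).trans h0, (le_sval hΔ _ hβ).trans h1,
    (le_sval hΔ _ hβ).trans h2⟩

/-- **S-world rigidity.**  In every world lying between the seven flattening points and the
`ω = 2` box, the support value of every nonnegative direction is its flattening value. -/
theorem sval_eq_flat7 {Δ : Set (Fin 6 → ℝ)} (hflat : ∀ q ∈ k4flat, q ∈ Δ) (hK : Δ ⊆ k4box 2)
    (u : Fin 6 → ℝ) (hu : ∀ i, 0 ≤ u i) : sval Δ u = flat7 u := by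
  have hΔ : Tame Δ := tame_of_subset_k4box ⟨k4s0, hflat k4s0 (by simp [k4flat])⟩ hK
  apply le_antisymm
  · apply sval_le hΔ
    intro β hβ
    obtain ⟨hb, ht, ht0, ht1, ht2⟩ := hK hβ
    have hf := dot_le_flat7 u
    exact flat_dominates u β hu hb ht ht0 ht1 ht2 (hf k4s0 (by simp [k4flat]))
      (hf k4s1 (by simp [k4flat])) (hf k4s2 (by simp [k4flat])) (hf k4s3 (by simp [k4flat]))
      (hf k4f1 (by simp [k4flat])) (hf k4f2 (by simp [k4flat])) (hf k4f3 (by simp [k4flat]))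
  · exact flat7_le (fun q hq => le_sval hΔ u (hflat q hq))

/-- the flat world is an S-world -/
theorem k4flatSet_subset_box_two : k4flatSet ⊆ k4box 2 := fun q hq => k4flat_subset_box le_rfl q hq

/-- support function of the flat world -/
theorem sval_k4flatSet (u : Fin 6 → ℝ) (hu : ∀ i, 0 ≤ u i) : sval k4flatSet u = flat7 u :=
  sval_eq_flat7 (fun _ hq => hq) k4flatSet_subset_box_two u hu

/-- every S-world has the support function of the flat world (nonnegative directions) -/
theorem sval_sWorld_eq {Δ : Set (Fin 6 → ℝ)} (hflat : ∀ q ∈ k4flat, q ∈ Δ) (hK : Δ ⊆ k4box 2)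
    (u : Fin 6 → ℝ) (hu : ∀ i, 0 ≤ u i) : sval Δ u = sval k4flatSet u := by
  rw [sval_eq_flat7 hflat hK u hu, sval_k4flatSet u hu]

/-- **Door D1 closed.**  A support-linear piece with nonnegative directions holds in an S-world iff
it holds in the flat world. -/
theorem holds_sWorld_iff (D : LinData (Fin 6)) (hdir : ∀ j i, 0 ≤ D.dir j i)
    {Δ : Set (Fin 6 → ℝ)} (hflat : ∀ q ∈ k4flat, q ∈ Δ) (hK : Δ ⊆ k4box 2) :
    D.holds Δ ↔ D.holds k4flatSet := by
  unfold LinData.holds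
  rw [Finset.sum_congr rfl (fun j _ => by rw [sval_sWorld_eq hflat hK (D.dir j) (hdir j)])]

/-- **«necessary for `ω = 2`» = «true at the flat world»** for support-linear pieces with
nonnegative directions (all exponent statements about weighted `K₄` objects): a piece holds in
EVERY S-world (every world between the flattening points and the `ω = 2` box) iff it holds in the
flat world `k4flatSet`. -/
theorem sNec_iff (D : LinData (Fin 6)) (hdir : ∀ j i, 0 ≤ D.dir j i) :
    (∀ Δ : Set (Fin 6 → ℝ), (∀ q ∈ k4flat, q ∈ Δ) → Δ ⊆ k4box 2 → D.holds Δ) ↔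
      D.holds k4flatSet :=
  ⟨fun h => h _ (fun _ hq => hq) k4flatSet_subset_box_two,
    fun h _ hflat hK => (holds_sWorld_iff D hdir hflat hK).mpr h⟩

/-- the `K₄` instance: over a record box, convexity / star-convexity laws never help -/
theorem forces_cons_convex_iff_box {ωbar : ℝ} {Δ₀ : Set (Fin 6 → ℝ)} (hne : Δ₀.Nonempty)
    (Ps : List (LinData (Fin 6))) :
    Forces Δ₀ (k4box ωbar) ((fun Δ => Convex ℝ Δ) :: Ps.map LinData.holds) (Cap k4tri 2) ↔
      Forces Δ₀ (k4box ωbar) (Ps.map LinData.holds) (Cap k4tri 2) :=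
  forces_cons_convex_iff hne (k4box_bddAbove ωbar) (k4box_convex ωbar) Ps k4tri 2

end Rigidity

end Summit.MatrixMultiplication.MatrixMultiplication.Theorems.TetraResidualNecessity
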